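import Literature.MathematicalPhysics.QuantumFieldTheory.OSPointVectors
import HarnessLib

/-!
# Configurations from time gaps, and their splitting at a gap (bookkeeping for OS II, Ch. V)

Topic `Literature/MathematicalPhysics/QuantumFieldTheory`; support file (all proved; small
definitions, no named facts) for the analytic continuation of the Schwinger functions in the time
differences (Osterwalder–Schrader, *Axioms for Euclidean Green's functions II*, Comm. Math. Phys.
42 (1975), §IV.2 and Ch. V: "in terms of the difference variables `ξ_k = x_{k+1} − x_k` …
`S_k(ζ⁰ | ξ⃗)`", and (5.2)/(5.4): the continuation in *one* time difference is the semigroup matrix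
element `(Ψₙ, e^{-τH} Ψₘ)` of the vectors of the two halves of the configuration). This file fixes,
for configurations `y` of `k + 2` points of `ℝ^d` (time = coordinate `0`):

* `gapsOf y` — the time gaps `y⁰_{i+1} − y⁰_i`; `gapCfg y τ` — the configuration with the spatial
  parts and the initial time of `y` and prescribed time gaps `τ` (`gapCfg y (gapsOf y) = y`,
  `gapsOf (gapCfg y τ) = τ`; ordered iff `τ > 0`; equivariant under diagonal translations; its
  norm);
* `leftBlock y i ε`, `rightBlock y i ε` — the two halves of `y` at the gap `i`, reflected resp.
  translated so as to become positive-time ordered configurations with first time `ε`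
  (`PosOrdered`), to which `OSPointVectors.pointVector` applies;
* `gramConfig_leftBlock_rightBlock` — **the Gram configuration of the two halves is the original
  configuration with the gap `i` replaced by `2ε + s`**, up to the reindexing
  `Fin (i+1+(k−i+1)) ≃ Fin (k+2)` and a diagonal time translation: the combinatorial content of
  OS's (5.2)/(5.4) at points.

## References

* K. Osterwalder, R. Schrader, *Axioms for Euclidean Green's functions II*, Comm. Math. Phys.
  42 (1975) 281–305, §IV.2, Ch. V (5.2), (5.4). [OsterwalderSchraderCMP1975]
-/

noncomputable section

open Set Finset

namespace Literature.MathematicalPhysics.QuantumFieldTheory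

open Literature.MathematicalPhysics.QuantumLattice (timeReflection timeReflection_apply)
open Literature.MathematicalPhysics.QuantumLattice.SchwingerFamily (timeVec timeVec_add timeVec_zero
  timeReflection_timeVec)

variable {d : ℕ} [NeZero d] {k : ℕ}

/-! ### Gaps and configurations with prescribed gaps -/

/-- **The time gaps** `(y⁰_{i+1} − y⁰_i)_i` of a configuration of `k + 2` points. [cite: OsterwalderSchraderCMP1975, §IV.2] -/
def gapsOf (y : Fin (k + 2) → EuclideanSpace ℝ (Fin d)) : Fin (k + 1) → ℝ :=
  fun i => y i.succ 0 - y (Fin.castSucc i) 0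

/-- **The configuration with prescribed time gaps**: same spatial parts and initial time as `y`,
times `y⁰_0 + ∑_{i<j} τ_i`. [cite: OsterwalderSchraderCMP1975, §IV.2] -/
def gapCfg (y : Fin (k + 2) → EuclideanSpace ℝ (Fin d)) (τ : Fin (k + 1) → ℝ) :
    Fin (k + 2) → EuclideanSpace ℝ (Fin d) :=
  fun j => y j + timeVec (y 0 0 + Fin.partialSum τ j - y j 0)

/-- Coordinates of `timeVec`. [folklore] -/
theorem timeVec_apply' (t : ℝ) (μ : Fin d) : (timeVec t : EuclideanSpace ℝ (Fin d)) μ = if μ = 0 then t else 0 := by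
  change (EuclideanSpace.single (0 : Fin d) t) μ = _
  rw [PiLp.single_apply]

/-- Times of `gapCfg`. [folklore] -/
@[simp] theorem gapCfg_apply_zero (y : Fin (k + 2) → EuclideanSpace ℝ (Fin d)) (τ : Fin (k + 1) → ℝ)
    (j : Fin (k + 2)) : gapCfg y τ j 0 = y 0 0 + Fin.partialSum τ j := by
  simp [gapCfg]

/-- Spatial parts of `gapCfg` are those of `y`. [folklore] -/
theorem gapCfg_apply_of_ne_zero (y : Fin (k + 2) → EuclideanSpace ℝ (Fin d)) (τ : Fin (k + 1) → ℝ)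
    (j : Fin (k + 2)) {μ : Fin d} (hμ : μ ≠ 0) : gapCfg y τ j μ = y j μ := by
  simp [gapCfg, hμ]

/-- The gaps of `gapCfg y τ` are `τ`. [folklore] -/
@[simp] theorem gapsOf_gapCfg (y : Fin (k + 2) → EuclideanSpace ℝ (Fin d)) (τ : Fin (k + 1) → ℝ) :
    gapsOf (gapCfg y τ) = τ := by
  funext i
  simp only [gapsOf]
  rw [gapCfg_apply_zero, gapCfg_apply_zero, Fin.partialSum_succ]
  ring

/-- `gapCfg y (gapsOf y) = y`. [folklore] -/
@[simp] theorem gapCfg_gapsOf (y : Fin (k + 2) → EuclideanSpace ℝ (Fin d)) : gapCfg y (gapsOf y) = y := by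
  funext j
  have htel : y 0 0 + Fin.partialSum (gapsOf y) j = y j 0 := by
    have h := congr_fun (Fin.partialSum_left_neg fun j : Fin (k + 2) => y j 0) j
    rw [Pi.vadd_apply, vadd_eq_add] at h
    rw [show gapsOf y = fun i => -(y (Fin.castSucc i) 0) + y i.succ 0 from
      funext fun i => by simp only [gapsOf]; ring]
    exact h
  ext μ
  by_cases hμ : μ = 0
  · subst hμ; rw [gapCfg_apply_zero, htel]
  · exact gapCfg_apply_of_ne_zero y _ j hμ

/-- Prescribing the gaps twice keeps the last prescription. [folklore] -/
theorem gapCfg_gapCfg (y : Fin (k + 2) → EuclideanSpace ℝ (Fin d)) (τ σ : Fin (k + 1) → ℝ) :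
    gapCfg (gapCfg y τ) σ = gapCfg y σ := by
  funext j; ext μ
  by_cases hμ : μ = 0
  · subst hμ; simp
  · simp [gapCfg_apply_of_ne_zero _ _ _ hμ]

/-- **`gapCfg y τ` is ordered iff the gaps are positive.** [folklore] -/
theorem gapCfg_mem_orderedRegion_iff (y : Fin (k + 2) → EuclideanSpace ℝ (Fin d)) (τ : Fin (k + 1) → ℝ) :
    gapCfg y τ ∈ orderedRegion k d ↔ ∀ i, 0 < τ i := by
  simp only [orderedRegion, mem_setOf_eq, gapCfg_apply_zero, Fin.partialSum_succ]
  exact forall_congr' fun i => by constructor <;> intro h <;> linarith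

/-- The gaps of an ordered configuration are positive. [folklore] -/
theorem gapsOf_pos {y : Fin (k + 2) → EuclideanSpace ℝ (Fin d)} (hy : y ∈ orderedRegion k d) (i : Fin (k + 1)) :
    0 < gapsOf y i :=
  sub_pos.2 (hy i)

/-- **Equivariance under diagonal translations.** [folklore] -/
theorem gapCfg_add_const (y : Fin (k + 2) → EuclideanSpace ℝ (Fin d)) (a : EuclideanSpace ℝ (Fin d))
    (τ : Fin (k + 1) → ℝ) : gapCfg (fun j => y j + a) τ = fun j => gapCfg y τ j + a := by
  funext j; ext μ
  by_cases hμ : μ = 0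
  · subst hμ; simp; ring
  · simp [gapCfg_apply_of_ne_zero _ _ _ hμ]

/-- **Changing the times of the base configuration only translates `gapCfg`** (by the change of
the initial time). [folklore] -/
theorem gapCfg_add_timeVec (y : Fin (k + 2) → EuclideanSpace ℝ (Fin d)) (c : Fin (k + 2) → ℝ)
    (τ : Fin (k + 1) → ℝ) :
    gapCfg (fun j => y j + timeVec (c j)) τ = fun j => gapCfg y τ j + timeVec (c 0) := by
  funext j; ext μ
  by_cases hμ : μ = 0
  · subst hμ; simp; ring
  · simp [gapCfg_apply_of_ne_zero _ _ _ hμ, hμ]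

/-- Norm of a point with modified time: `‖p + t e₀‖ ≤ ‖p‖ + |t|`. [folklore] -/
theorem norm_add_timeVec_le (p : EuclideanSpace ℝ (Fin d)) (t : ℝ) : ‖p + timeVec t‖ ≤ ‖p‖ + |t| := by
  refine (norm_add_le _ _).trans ?_
  rw [timeVec, PiLp.norm_single, Real.norm_eq_abs]

/-- `‖p − t e₀‖ ≤ ‖p‖ + |t|`. [folklore] -/
theorem norm_sub_timeVec_le (p : EuclideanSpace ℝ (Fin d)) (t : ℝ) : ‖p - timeVec t‖ ≤ ‖p‖ + |t| := by
  refine (norm_sub_le _ _).trans ?_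
  rw [timeVec, PiLp.norm_single, Real.norm_eq_abs]

/-- The partial sums of the gaps are bounded by their `ℓ¹` norm. [folklore] -/
theorem abs_partialSum_le (τ : Fin (k + 1) → ℝ) (j : Fin (k + 2)) : |Fin.partialSum τ j| ≤ ∑ i, |τ i| := by
  rw [partialSum_eq_sum_filter]
  refine (Finset.abs_sum_le_sum_abs _ _).trans ?_
  exact Finset.sum_le_sum_of_subset_of_nonneg (Finset.filter_subset _ _) fun _ _ _ => abs_nonneg _

/-- **Norm of `gapCfg`**: `‖gapCfg y τ‖ ≤ 3‖y‖ + ∑ |τ_i|`. [folklore] -/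
theorem norm_gapCfg_le (y : Fin (k + 2) → EuclideanSpace ℝ (Fin d)) (τ : Fin (k + 1) → ℝ) :
    ‖gapCfg y τ‖ ≤ 3 * ‖y‖ + ∑ i, |τ i| := by
  refine (pi_norm_le_iff_of_nonneg (by positivity)).2 fun j => ?_
  refine (norm_add_timeVec_le _ _).trans ?_
  have h1 : ‖y j‖ ≤ ‖y‖ := norm_le_pi_norm y j
  have h2 : |y 0 0| ≤ ‖y‖ := by
    have h := PiLp.norm_apply_le (y 0) 0
    rw [Real.norm_eq_abs] at h
    exact h.trans (norm_le_pi_norm y 0)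
  have h3 : |y j 0| ≤ ‖y‖ := by
    have h := PiLp.norm_apply_le (y j) 0
    rw [Real.norm_eq_abs] at h
    exact h.trans (norm_le_pi_norm y j)
  have h4 := abs_partialSum_le τ j
  have h5 : |y 0 0 + Fin.partialSum τ j - y j 0| ≤ |y 0 0| + |Fin.partialSum τ j| + |y j 0| := by
    refine (abs_sub _ _).trans (add_le_add (abs_add_le _ _) le_rfl)
  linarith

/-! ### The two halves of a configuration at a gap -/

/-- **The left half at the gap `i`, reflected**: the points `y_i, y_{i-1}, …, y_0` time-reflected
about `y⁰_i + ε`, a positive-time ordered configuration of `i + 1` points with first time `ε`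
(OS's `Ψₙ(x, ξ)` data on the left of the split). [cite: OsterwalderSchraderCMP1975, Ch. V (5.2)] -/
def leftBlock (y : Fin (k + 2) → EuclideanSpace ℝ (Fin d)) (i : Fin (k + 1)) (ε : ℝ) :
    Fin (i.val + 1) → EuclideanSpace ℝ (Fin d) :=
  fun j => timeReflection d (y ⟨i.val - j.val, by omega⟩ - timeVec (y (Fin.castSucc i) 0 + ε))

/-- **The right half at the gap `i`, translated**: the points `y_{i+1}, …, y_{k+1}` translated in
time so that the first has time `ε` (OS's `Ψₘ(x', ξ')` data on the right of the split). [cite: OsterwalderSchraderCMP1975, Ch. V (5.2)] -/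
def rightBlock (y : Fin (k + 2) → EuclideanSpace ℝ (Fin d)) (i : Fin (k + 1)) (ε : ℝ) :
    Fin (k - i.val + 1) → EuclideanSpace ℝ (Fin d) :=
  fun j => y ⟨i.val + 1 + j.val, by omega⟩ - timeVec (y i.succ 0 - ε)

/-- Times of the left half: `ε + (y⁰_i − y⁰_{i-j})`. [folklore] -/
theorem leftBlock_apply_zero (y : Fin (k + 2) → EuclideanSpace ℝ (Fin d)) (i : Fin (k + 1)) (ε : ℝ) (j : Fin (i.val + 1)) :
    leftBlock y i ε j 0 = ε + (y (Fin.castSucc i) 0 - y ⟨i.val - j.val, by omega⟩ 0) := by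
  simp [leftBlock, timeReflection_apply]
  ring

/-- Spatial parts of the left half. [folklore] -/
theorem leftBlock_apply_of_ne_zero (y : Fin (k + 2) → EuclideanSpace ℝ (Fin d)) (i : Fin (k + 1)) (ε : ℝ)
    (j : Fin (i.val + 1)) {μ : Fin d} (hμ : μ ≠ 0) : leftBlock y i ε j μ = y ⟨i.val - j.val, by omega⟩ μ := by
  simp [leftBlock, timeReflection_apply, hμ]

/-- Times of the right half: `ε + (y⁰_{i+1+j} − y⁰_{i+1})`. [folklore] -/
theorem rightBlock_apply_zero (y : Fin (k + 2) → EuclideanSpace ℝ (Fin d)) (i : Fin (k + 1)) (ε : ℝ) (j : Fin (k - i.val + 1)) :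
    rightBlock y i ε j 0 = ε + (y ⟨i.val + 1 + j.val, by omega⟩ 0 - y i.succ 0) := by
  simp [rightBlock]
  ring

/-- Spatial parts of the right half. [folklore] -/
theorem rightBlock_apply_of_ne_zero (y : Fin (k + 2) → EuclideanSpace ℝ (Fin d)) (i : Fin (k + 1)) (ε : ℝ)
    (j : Fin (k - i.val + 1)) {μ : Fin d} (hμ : μ ≠ 0) : rightBlock y i ε j μ = y ⟨i.val + 1 + j.val, by omega⟩ μ := by
  simp [rightBlock, hμ]

/-- Times of an ordered configuration are strictly monotone in the index. [folklore] -/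
theorem strictMono_time_of_mem_orderedRegion {y : Fin (k + 2) → EuclideanSpace ℝ (Fin d)} (hy : y ∈ orderedRegion k d) :
    StrictMono fun j => y j 0 :=
  (strictMono_time_iff y).2 hy

/-- **The left half is positive-time ordered** with first time `ε > 0`. [folklore] -/
theorem posOrdered_leftBlock {y : Fin (k + 2) → EuclideanSpace ℝ (Fin d)} (hy : y ∈ orderedRegion k d) (i : Fin (k + 1))
    {ε : ℝ} (hε : 0 < ε) : PosOrdered (leftBlock y i ε) := by
  have hmono := strictMono_time_of_mem_orderedRegion hy
  refine ⟨?_, fun j j' hjj' => ?_⟩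
  · rw [leftBlock_apply_zero]
    have : (⟨i.val - (0 : Fin (i.val + 1)).val, by omega⟩ : Fin (k + 2)) = Fin.castSucc i := Fin.ext (by simp)
    rw [this, sub_self, add_zero]
    exact hε
  · simp only [leftBlock_apply_zero]
    have hlt : (⟨i.val - j'.val, by omega⟩ : Fin (k + 2)) < ⟨i.val - j.val, by omega⟩ := by
      rw [Fin.lt_def]
      have h1 : j.val < j'.val := hjj'
      have h2 : j'.val ≤ i.val := Nat.lt_succ_iff.1 j'.2
      simp only
      omega
    have := hmono hlt
    simp only at this
    linarith

/-- **The right half is positive-time ordered** with first time `ε > 0`. [folklore] -/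
theorem posOrdered_rightBlock {y : Fin (k + 2) → EuclideanSpace ℝ (Fin d)} (hy : y ∈ orderedRegion k d) (i : Fin (k + 1))
    {ε : ℝ} (hε : 0 < ε) : PosOrdered (rightBlock y i ε) := by
  have hmono := strictMono_time_of_mem_orderedRegion hy
  refine ⟨?_, fun j j' hjj' => ?_⟩
  · rw [rightBlock_apply_zero]
    have : (⟨i.val + 1 + (0 : Fin (k - i.val + 1)).val, by omega⟩ : Fin (k + 2)) = i.succ := Fin.ext (by simp)
    rw [this, sub_self, add_zero]
    exact hε
  · simp only [rightBlock_apply_zero]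
    have hlt : (⟨i.val + 1 + j.val, by omega⟩ : Fin (k + 2)) < ⟨i.val + 1 + j'.val, by omega⟩ := by
      rw [Fin.lt_def]
      have h1 : j.val < j'.val := hjj'
      simp only
      omega
    have := hmono hlt
    simp only at this
    linarith

/-- First time of the left half. [folklore] -/
theorem leftBlock_zero_apply_zero (y : Fin (k + 2) → EuclideanSpace ℝ (Fin d)) (i : Fin (k + 1)) (ε : ℝ) :
    leftBlock y i ε 0 0 = ε := by
  rw [leftBlock_apply_zero]
  have : (⟨i.val - (0 : Fin (i.val + 1)).val, by omega⟩ : Fin (k + 2)) = Fin.castSucc i := Fin.ext (by simp)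
  rw [this, sub_self, add_zero]

/-- First time of the right half. [folklore] -/
theorem rightBlock_zero_apply_zero (y : Fin (k + 2) → EuclideanSpace ℝ (Fin d)) (i : Fin (k + 1)) (ε : ℝ) :
    rightBlock y i ε 0 0 = ε := by
  rw [rightBlock_apply_zero]
  have : (⟨i.val + 1 + (0 : Fin (k - i.val + 1)).val, by omega⟩ : Fin (k + 2)) = i.succ := Fin.ext (by simp)
  rw [this, sub_self, add_zero]

/-! ### The Gram configuration of the two halves -/

/-- The index arithmetic of the split: `i + 1 + (k − i + 1) = k + 2`. [folklore] -/
theorem split_add_eq (i : Fin (k + 1)) : i.val + 1 + (k - i.val + 1) = k + 2 := by omega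

/-- **Partial sums of an updated sequence.** [folklore] -/
theorem partialSum_update (τ : Fin (k + 1) → ℝ) (i : Fin (k + 1)) (g : ℝ) (j : Fin (k + 2)) :
    Fin.partialSum (Function.update τ i g) j =
      Fin.partialSum τ j + if i.val < j.val then g - τ i else 0 := by
  induction j using Fin.induction with
  | zero => simp
  | succ j' ih =>
    rw [Fin.partialSum_succ, Fin.partialSum_succ, ih]
    by_cases hji : j' = i
    · subst hji
      simp only [Function.update_self, Fin.val_succ, Fin.val_castSucc, lt_irrefl, if_false,
        Nat.lt_succ_self, if_true]
      ring
    · rw [Function.update_of_ne hji]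
      have h1 : (i.val < (Fin.castSucc j').val) ↔ (i.val < (j'.succ : Fin (k + 2)).val) := by
        simp only [Fin.val_castSucc, Fin.val_succ]
        constructor
        · omega
        · intro h
          have : i.val ≠ j'.val := fun h' => hji (Fin.ext h'.symm)
          omega
      by_cases hlt : i.val < (Fin.castSucc j').val
      · rw [if_pos hlt, if_pos (h1.1 hlt)]; ring
      · rw [if_neg hlt, if_neg (fun h => hlt (h1.2 h))]; ring

/-- **The Gram configuration of the two halves of `y` at the gap `i` is `y` with the gap `i`
replaced by `2ε + s`, translated in time by `−(y⁰_i + ε)`** (after the reindexing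
`Fin (i+1+(k−i+1)) → Fin (k+2)`): the pointwise content of OS's
`(Ψₙ(x, ξ), e^{-τH} Ψₘ(x', ξ')) = S_{n+m-1}(−ξ̃, x + x' + τ, ξ')` (5.2)/(5.4). [cite: OsterwalderSchraderCMP1975, Ch. V (5.2), (5.4)] -/
theorem gramConfig_leftBlock_rightBlock {y : Fin (k + 2) → EuclideanSpace ℝ (Fin d)} (i : Fin (k + 1)) (ε s : ℝ)
    (J : Fin (i.val + 1 + (k - i.val + 1))) :
    gramConfig (leftBlock y i ε) (fun j => rightBlock y i ε j + timeVec s) J =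
      gapCfg y (Function.update (gapsOf y) i (2 * ε + s)) (Fin.cast (split_add_eq i) J) +
        timeVec (-(y (Fin.castSucc i) 0 + ε)) := by
  -- the target configuration, coordinatewise
  have htime : ∀ J' : Fin (k + 2), gapCfg y (Function.update (gapsOf y) i (2 * ε + s)) J' 0 =
      y J' 0 + if i.val < J'.val then 2 * ε + s - gapsOf y i else 0 := by
    intro J'
    rw [gapCfg_apply_zero, partialSum_update]
    have htel : y 0 0 + Fin.partialSum (gapsOf y) J' = y J' 0 := by
      have h := gapCfg_apply_zero y (gapsOf y) J'
      rw [gapCfg_gapsOf] at h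
      exact h.symm
    linarith
  induction J using Fin.addCases with
  | left j =>
    rw [gramConfig, Fin.append_left]
    have hidx : (Fin.cast (split_add_eq i) (Fin.castAdd (k - i.val + 1) j) : Fin (k + 2)) =
        ⟨i.val - (Fin.rev j).val, by omega⟩ := Fin.ext (by simp [Fin.val_rev]; omega)
    rw [hidx]
    ext μ
    by_cases hμ : μ = 0
    · subst hμ
      simp only [timeReflection_apply, if_true, PiLp.add_apply]
      rw [leftBlock_apply_zero, htime]
      have hnot : ¬ (i.val < (⟨i.val - (Fin.rev j).val, by omega⟩ : Fin (k + 2)).val) := by simp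
      rw [if_neg hnot, timeVec_apply', if_pos rfl]
      ring
    · rw [timeReflection_apply, if_neg hμ, leftBlock_apply_of_ne_zero _ _ _ _ hμ, PiLp.add_apply,
        gapCfg_apply_of_ne_zero _ _ _ hμ, timeVec_apply', if_neg hμ, add_zero]
  | right j =>
    rw [gramConfig, Fin.append_right]
    have hidx : (Fin.cast (split_add_eq i) (Fin.natAdd (i.val + 1) j) : Fin (k + 2)) =
        ⟨i.val + 1 + j.val, by omega⟩ := Fin.ext (by simp)
    rw [hidx]
    ext μ
    by_cases hμ : μ = 0
    · subst hμ
      simp only [PiLp.add_apply]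
      rw [rightBlock_apply_zero, htime]
      have hlt : i.val < (⟨i.val + 1 + j.val, by omega⟩ : Fin (k + 2)).val := by simp; omega
      rw [if_pos hlt, timeVec_apply', if_pos rfl, timeVec_apply', if_pos rfl]
      simp only [gapsOf]
      ring
    · rw [PiLp.add_apply, PiLp.add_apply, rightBlock_apply_of_ne_zero _ _ _ _ hμ, gapCfg_apply_of_ne_zero _ _ _ hμ,
        timeVec_apply', if_neg hμ, timeVec_apply', if_neg hμ, add_zero]

/-! ### Norms of the halves and of Gram configurations -/

/-- **Norm of a Gram configuration**: `‖gramConfig x' x‖ ≤ max ‖x'‖ ‖x‖` (time reflection is an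
isometry). [folklore] -/
theorem norm_gramConfig_le {m' m : ℕ} (x' : Fin (m' + 1) → EuclideanSpace ℝ (Fin d)) (x : Fin (m + 1) → EuclideanSpace ℝ (Fin d)) :
    ‖gramConfig x' x‖ ≤ max ‖x'‖ ‖x‖ := by
  refine (pi_norm_le_iff_of_nonneg (by positivity)).2 fun J => ?_
  induction J using Fin.addCases with
  | left j =>
    rw [gramConfig, Fin.append_left, LinearIsometryEquiv.norm_map]
    exact (norm_le_pi_norm x' _).trans (le_max_left _ _)
  | right j =>
    rw [gramConfig, Fin.append_right]
    exact (norm_le_pi_norm x _).trans (le_max_right _ _)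

omit [NeZero d] in
/-- A coordinate of a configuration is bounded by its norm. [folklore] -/
theorem abs_apply_apply_le_norm {n : ℕ} (y : Fin n → EuclideanSpace ℝ (Fin d)) (j : Fin n) (μ : Fin d) : |y j μ| ≤ ‖y‖ := by
  have h := PiLp.norm_apply_le (y j) μ
  rw [Real.norm_eq_abs] at h
  exact h.trans (norm_le_pi_norm y j)

/-- **Norm of the left half**: `‖leftBlock y i ε‖ ≤ 2‖y‖ + |ε|`. [folklore] -/
theorem norm_leftBlock_le (y : Fin (k + 2) → EuclideanSpace ℝ (Fin d)) (i : Fin (k + 1)) (ε : ℝ) :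
    ‖leftBlock y i ε‖ ≤ 2 * ‖y‖ + |ε| := by
  refine (pi_norm_le_iff_of_nonneg (by positivity)).2 fun j => ?_
  rw [leftBlock, LinearIsometryEquiv.norm_map]
  refine (norm_sub_timeVec_le _ _).trans ?_
  have h1 := norm_le_pi_norm y ⟨i.val - j.val, by omega⟩
  have h2 := abs_apply_apply_le_norm y (Fin.castSucc i) 0
  have h3 : |y (Fin.castSucc i) 0 + ε| ≤ |y (Fin.castSucc i) 0| + |ε| := abs_add_le _ _
  linarith

/-- **Norm of the right half**: `‖rightBlock y i ε‖ ≤ 2‖y‖ + |ε|`. [folklore] -/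
theorem norm_rightBlock_le (y : Fin (k + 2) → EuclideanSpace ℝ (Fin d)) (i : Fin (k + 1)) (ε : ℝ) :
    ‖rightBlock y i ε‖ ≤ 2 * ‖y‖ + |ε| := by
  refine (pi_norm_le_iff_of_nonneg (by positivity)).2 fun j => ?_
  rw [rightBlock]
  refine (norm_sub_timeVec_le _ _).trans ?_
  have h1 := norm_le_pi_norm y ⟨i.val + 1 + j.val, by omega⟩
  have h2 := abs_apply_apply_le_norm y i.succ 0
  have h3 : |y i.succ 0 - ε| ≤ |y i.succ 0| + |ε| := abs_sub _ _
  linarith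

/-- The halves translated in time by `t`: `rightBlock y i ε + t e₀ = rightBlock y i (ε + t)`. [folklore] -/
theorem rightBlock_add_timeVec (y : Fin (k + 2) → EuclideanSpace ℝ (Fin d)) (i : Fin (k + 1)) (ε t : ℝ) :
    (fun j => rightBlock y i ε j + timeVec t) = rightBlock y i (ε + t) := by
  funext j; ext μ
  simp only [rightBlock, PiLp.add_apply, PiLp.sub_apply, timeVec_apply']
  split_ifs <;> ring

end Literature.MathematicalPhysics.QuantumFieldTheory
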